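import Mathlib

/-!
# Fusion-number-one Gluck balls: the Whitney-matching identity (GNS Question 5.4, bookkeeping layer)

Host summit `SmoothPoincare4` (soloist seat `solo-SmoothPoincare4-informed`), rung
`GluckBallDoubleConjecture` (`SoloInformedGluckBalls.lean`), sub-rung: D. Gabai, P. Naylor,
H. Schwartz, *Doubles of Gluck twists: a five-dimensional approach*, arXiv:2307.06388 (Adv. Math.
2025), Question 5.4 — `Σ_S° × I ≅ B⁵` when one ribbon hemisphere `A` of the 2-knot `S = A ∪ B̄` has
FUSION NUMBER ONE (two minima `U₁, U₂`, one band `b`) but arbitrary undisking number.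

## The dictionary (prose; the topology is NOT formalised here)
Read the band core from its `U₁`-end and record one letter per transverse passage through the
spanning disc of `U₁` (an `x₁`-letter, `disc = true`) or of `U₂` (`disc = false`), with its
direction (`pos`).  In GNS's 5-dimensional handle structure of `W_S = Σ_S° × I` (their Lemma 2.7,
Remark 2.10, §4) keep the 3-handle `R = ∂N(spanning disc of U₁)`; it meets the belt sphere `G` of the
fusion handle in `1 + 2·#{x₁-letters}` points: the rim exit `e` (sign `+`) and, for the `k`-th
letter if it is an `x₁`-letter, an entry point `in_k` (sign `−`) and an exit point `out_k` (sign `+`).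
Label each point by the exponent sum of the word read up to it: `J(e) = 0`, `J(in_k) = W_{k-1}`,
`J(out_k) = W_k` (`W_k` = exponent sum of the first `k` letters, ALL letters counted).  The soloist's
work note `work/fusion1/fusion-one-alexander.md` (HOME of the seat) argues — in prose, status
*conjecture/claimed*, not kernel-checked — that for a Whitney circle pairing `P` with `Q` the
algebraic number of passages of ANY Whitney disc over the Gluck 2-handle `h_*` equals
`±(J(P) − J(Q))` (it is the total linking number of the circle with the dotted unlink), so that a
complete matching by `h_*`-unlinked pairs exists iff the multiset of `J`-labels of the `−` points is
contained in that of the `+` points.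

## What IS kernel-checked here (pure combinatorics of words)
* `outCount W w n − inCount W w n = foxCoeff W w (n-1) − foxCoeff W w n` (`out_sub_in`): the signed
  count of `±` points with label `n` telescopes to the coefficientwise form of
  `genfun(+) − genfun(−) = 1 + (t − 1)·α(∂w/∂x₁)`, where `foxCoeff` is the abelianised Fox derivative
  of the word with respect to `x₁` (`∂x₁/∂x₁ = 1 ↦ t^{W}`, `∂x₁⁻¹/∂x₁ = −x₁⁻¹ ↦ −t^{W-1}`), i.e.
  `aplus w n − aminus w n = alexCoeff w n` (`aplus_sub_aminus`) with `alexCoeff` the `n`-th coefficient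
  of `Δ_A(t) := 1 + (t−1)·α(∂w/∂x₁)` = the Alexander polynomial of the ribbon DISC `A` computed from its
  one-relator ribbon presentation `⟨x₁, x₂ | x₁ = w x₂ w⁻¹⟩` (normalised `Δ_A(1) = 1`; the knot has
  `Δ_K(t) ≐ Δ_A(t)Δ_A(t⁻¹)`).
* `matchable_iff_alexCoeff_nonneg`: (∀ n, aminus w n ≤ aplus w n) ↔ (∀ n, 0 ≤ alexCoeff w n) — with the
  dictionary: an `h_*`-unlinked complete matching exists iff `Δ_A` has no negative coefficient, i.e.
  (as `Δ_A(1) = 1`) iff `Δ_A` is a monomial.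
* two evaluated examples (`example`s by `decide`): the GNS-type word `x₂⁻¹x₁` has a negative
  coefficient (their forced Gluck-linked Whitney disc), the length-5 word `w₁ = x₂x₁x₂⁻¹x₂⁻¹x₁` has none.

Nothing in this file asserts anything about manifolds; it is the certified arithmetic behind the
soloist's claims C17–C19 (HOME `CLAIMS.jsonl`), whose topological halves remain prose.
-/

namespace Summit.SmoothPoincare4.SmoothPoincare4.Theorems

namespace FusionOne

/-- A letter of a band word: `disc = true` for a passage through the spanning disc of `U₁`
(an `x₁`-letter), `false` for `U₂`; `pos = true` for the positive direction. -/
structure Letter where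
  disc : Bool
  pos : Bool
deriving DecidableEq, Repr

/-- Number of `x₁`-letters whose ENTRY label (prefix exponent sum before the letter, starting the
count at `W`) equals `n`: the `−` points of `R ∩ G` with `J = n`. -/
def inCount : ℤ → List Letter → ℤ → ℤ
  | _, [], _ => 0
  | W, ⟨true, true⟩ :: w, n => (if W = n then 1 else 0) + inCount (W + 1) w n
  | W, ⟨true, false⟩ :: w, n => (if W = n then 1 else 0) + inCount (W - 1) w n
  | W, ⟨false, true⟩ :: w, n => inCount (W + 1) w n
  | W, ⟨false, false⟩ :: w, n => inCount (W - 1) w n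

/-- Number of `x₁`-letters whose EXIT label (prefix exponent sum after the letter) equals `n`:
the `+` points of `R ∩ G` other than the rim point, with `J = n`. -/
def outCount : ℤ → List Letter → ℤ → ℤ
  | _, [], _ => 0
  | W, ⟨true, true⟩ :: w, n => (if W + 1 = n then 1 else 0) + outCount (W + 1) w n
  | W, ⟨true, false⟩ :: w, n => (if W - 1 = n then 1 else 0) + outCount (W - 1) w n
  | W, ⟨false, true⟩ :: w, n => outCount (W + 1) w n
  | W, ⟨false, false⟩ :: w, n => outCount (W - 1) w n

/-- Coefficient of `t^n` in the abelianised Fox derivative `α(∂w/∂x₁)`, the prefix exponent sum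
starting at `W`: an `x₁` at prefix value `W` contributes `+t^W`, an `x₁⁻¹` contributes `−t^{W-1}`. -/
def foxCoeff : ℤ → List Letter → ℤ → ℤ
  | _, [], _ => 0
  | W, ⟨true, true⟩ :: w, n => (if W = n then 1 else 0) + foxCoeff (W + 1) w n
  | W, ⟨true, false⟩ :: w, n => (if W - 1 = n then -1 else 0) + foxCoeff (W - 1) w n
  | W, ⟨false, true⟩ :: w, n => foxCoeff (W + 1) w n
  | W, ⟨false, false⟩ :: w, n => foxCoeff (W - 1) w n

/-- Multiplicity of the label `n` among the `+` points (rim point `e` has label `0`). -/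
def aplus (w : List Letter) (n : ℤ) : ℤ := (if n = 0 then 1 else 0) + outCount 0 w n

/-- Multiplicity of the label `n` among the `−` points. -/
def aminus (w : List Letter) (n : ℤ) : ℤ := inCount 0 w n

/-- Coefficient of `t^n` in `Δ_A(t) = 1 + (t − 1)·α(∂w/∂x₁)`. -/
def alexCoeff (w : List Letter) (n : ℤ) : ℤ :=
  (if n = 0 then 1 else 0) + (foxCoeff 0 w (n - 1) - foxCoeff 0 w n)

/-- The telescoping identity behind the matching criterion, with a general starting label `W`. -/
theorem out_sub_in (w : List Letter) :
    ∀ W n : ℤ, outCount W w n - inCount W w n = foxCoeff W w (n - 1) - foxCoeff W w n := by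
  induction w with
  | nil => intro W n; simp [outCount, inCount, foxCoeff]
  | cons a w ih =>
    intro W n
    obtain ⟨d, p⟩ := a
    cases d with
    | false =>
      cases p with
      | true => simp only [outCount, inCount, foxCoeff]; exact ih _ n
      | false => simp only [outCount, inCount, foxCoeff]; exact ih _ n
    | true =>
      cases p with
      | true =>
        have h := ih (W + 1) n
        simp only [outCount, inCount, foxCoeff]
        split_ifs <;> omega
      | false =>
        have h := ih (W - 1) n
        simp only [outCount, inCount, foxCoeff]
        split_ifs <;> omega

/-- MATCHING IDENTITY: (number of `+` points with label `n`) − (number of `−` points with label `n`)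
= `n`-th coefficient of `Δ_A(t) = 1 + (t−1)·α(∂w/∂x₁)`. -/
theorem aplus_sub_aminus (w : List Letter) (n : ℤ) :
    aplus w n - aminus w n = alexCoeff w n := by
  have h := out_sub_in w 0 n
  simp only [aplus, aminus, alexCoeff]
  omega

/-- An `h_*`-unlinked complete matching of the `−` points into the `+` points, label-preserving,
exists iff no label is in deficit, i.e. iff `Δ_A` has no negative coefficient. -/
theorem matchable_iff_alexCoeff_nonneg (w : List Letter) :
    (∀ n : ℤ, aminus w n ≤ aplus w n) ↔ (∀ n : ℤ, 0 ≤ alexCoeff w n) := by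
  constructor
  · intro h n; have := aplus_sub_aminus w n; have := h n; omega
  · intro h n; have := aplus_sub_aminus w n; have := h n; omega

/-- GNS's own case (one passage, e.g. the `6₁`-type word `x₂⁻¹ x₁`): `Δ_A = 2 − t⁻¹` has a negative
coefficient at `t⁻¹` — one Whitney disc is forced over the Gluck handle (their Figure 18). -/
example : alexCoeff [⟨false, false⟩, ⟨true, true⟩] (-1) = -1 ∧
    alexCoeff [⟨false, false⟩, ⟨true, true⟩] 0 = 2 := by decide

/-- The length-5 word `w₁ = x₂ x₁ x₂⁻¹ x₂⁻¹ x₁`: `Δ_A = t²`, no deficit at the labels that occur. -/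
example : alexCoeff [⟨false, true⟩, ⟨true, true⟩, ⟨false, false⟩, ⟨false, false⟩, ⟨true, true⟩] 2 = 1 ∧
    alexCoeff [⟨false, true⟩, ⟨true, true⟩, ⟨false, false⟩, ⟨false, false⟩, ⟨true, true⟩] 1 = 0 ∧
    alexCoeff [⟨false, true⟩, ⟨true, true⟩, ⟨false, false⟩, ⟨false, false⟩, ⟨true, true⟩] 0 = 0 ∧
    alexCoeff [⟨false, true⟩, ⟨true, true⟩, ⟨false, false⟩, ⟨false, false⟩, ⟨true, true⟩] (-1) = 0 := by
  decide

end FusionOne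

end Summit.SmoothPoincare4.SmoothPoincare4.Theorems
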